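import Mathlib
import Literature.NumberTheory.DiophantineGeometry.AbcWave0MihailescuProofs
import HarnessLib

/-!
# ABCAtLeastThreePrimes

Topic `Literature/Uncategorized`. Named literature fact(s) relocated by the gate from `Summits/ABC/ABC/Theorems/SoloBlindTwoPrimes.lean`
(accept-time relocation of `[cite]`d propositions written inline in a Summits proposal; human ruling 2026-08-15).

* `Literature.Uncategorized.ABCAtLeastThreePrimes`
-/

namespace Literature.Uncategorized

open UniqueFactorizationMonoid Finset
open Literature.NumberTheory.DiophantineGeometry

/-- `ABC` restricted to triples with at least three prime factors (the first open case is support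
`{2, p, q}`). [folklore] -/
def ABCAtLeastThreePrimes : Prop :=
  ∀ ε : ℝ, 0 < ε → ∃ C : ℝ, 0 < C ∧ ∀ a b c : ℕ, IsABCTriple a b c →
    3 ≤ (a * b * c).primeFactors.card → (c : ℝ) < C * ((rad a b c : ℕ) : ℝ) ^ (1 + ε)

end Literature.Uncategorized
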